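import Literature.AnabelianGeometry.EtaleTheta.Discharge.Sec5DivTransportAssembly
import Literature.AnabelianGeometry.EtaleTheta.Discharge.Sec5Thm57RootDivisorsFixedOfTransport

/-!
# [EtTh] §5, Thm. 5.7: descent of the fixed root divisors from `A_N` to `A_⊚` — at the BASE-COMPATIBLE anchor `Ψ(A_⊚) ⥲ A_⊚`
# the divisor transport `Ψ^Φ_{A_⊚}` FIXES the zero part and the pole part of `div(Θ̈)` ((T-div), Frobenioid side, part 3)
# (pp. 325–326, 329–330 / PDF pp. 99–100, 103–104)

Mochizuki, *The étale theta function and its Frobenioid-theoretic manifestations*, Publ. RIMS **45** (2009): Prop. 5.3 p.325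
(PDF p.99) (`Ψ^Φ_{A_⊚}` for a CHOSEN `Ψ(A_⊚) ⥲ A_⊚`), Prop. 5.3 (vi) p.326, Thm. 5.6 proof p.329 (PDF p.103), Thm. 5.7 p.330 (PDF p.104)
(«possible translation by an element of … `l·ℤ`»); §5 p.330 («the zero divisor `Div(s_N)` … descends … to `Φ(A_⊚)`»)
[cite: MochizukiEtTh2009, Prop 5.3 p.325 (PDF p.99); Thm 5.7 p.330 (PDF p.104)]; [FrdI] Thm. 4.9 p.88 (naturality of `Ψ^Φ`)
[cite: MochizukiFrdI2008, Thm. 4.9 p.88].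

Cell abc-iut, layer L2, seat abc-iut-L2-d3 (gen 7), row R532 «(T-div)».  PROOF-ONLY (0 definitions, no new named fact) over this
seat's (T1) `Sec5Thm57RootDivisorsFixedOfTransport` (p464587) and abc-iut-w5-d245's `Sec5DivTransportAssembly` (p447656) — the
latter's descent mechanics («LINK (b)/(d)») READ BACKWARDS.

THE POINT.  (T1) says: for a normalised transport `(a, b, w)` of the root pair the `a`-anchored divisor transport
`ψ_a = (pullIso a)⁻¹ ∘ Ψ^Φ_{A_N}` fixes `Div(s^⊓_N)`, `Div(s^⊔_N) ∈ Φ(A_N)`.  The chain-of-components labels (Prop. 5.3 (v)) and the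
divisor `div(Θ̈) = Z₀·W₀⁻¹` live at `A_⊚` (`Φ(A_⊚)`, abc-iut-L2-t4's `DivisorPrimeData`); the root divisors DESCEND: `Div(s^⊓_N)^n = φ^* Z₀`,
`Div(s^⊔_N)^n = φ^* W₀` along `φ : A_N → A_⊚` (LINK (b), `hdesc`).  Here, from the naturality of `Ψ^Φ` along `φ`, the transitive
torsor law of `A_N^bs → A_⊚^bs` (`hGal`, [SemiAnbd] Rmk. 3.1.3) and the Galois DESCENT of base automorphisms of `A_N` to `C`-automorphisms
of `A_⊚` (`hGalDesc`: `A_⊚^bs` is Galois — «characteristic», p.322 — and `A_⊚` Aut-ample), we produce the anchor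
**`ι_a : Ψ(A_⊚) ⥲ A_⊚` BASE-COMPATIBLE with `a` along `φ`** (`(a⁻¹ ≫ Ψ(φ) ≫ ι_a)^bs = φ^bs`) and show
**`(Ψ^Φ_{A_⊚, ι_a})^gp` FIXES `Z₀` AND `W₀`** (hence `div(Θ̈)`), given the injectivity of `(φ^bs)^*` on `Φ(A_⊚)^gp` (`hinjφ`, a
structural binder: pull-back of divisors along the covering `A_N^bs → A_⊚^bs`).  With (T2) (`Sec5Thm57LabelTranslationOfFixedProfile`):
`Ψ^Φ_{A_⊚, ι_a}` acts on the chain of components as the identity or the reflection — the Frobenioid side of (T-div) is then complete;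
the remaining input (T3) is the dictionary with the Galois shadow of `Ψ`.
* `exists_psiPhiN_fixes_rootPair_natural_of_transport` — (T1)'s fixedness for an `e_N` that is NATURAL along every `A_N → A_⊚`
  relative to `e = Ψ^Φ_{A_⊚}`;
* `base_map_anchor_corrected` / `psiPhiN_pull_eq_pull_psiPhi` — bookkeeping: base-compatibility of the corrected anchor
  `ι₀ ≪≫ g⁻¹` and the KEY square `ψ_a ∘ (φ^bs)^* = (φ^bs)^* ∘ Ψ^Φ_{A_⊚, ι_a}`;
* **`exists_baseCompatible_anchor_psiPhi_fixes_of_transport`** — the statement above.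
HONEST FRAMING: kernel-checked bookkeeping; the binders `induced` ([FrdI] Thm. 4.9), `hGal`, `hGalDesc`, `hinjφ`, `hdesc` (LINK (b))
are asserted nowhere; nothing of [EtTh] is claimed for an actual curve; typed ≠ discharged; no side taken on [IUTchIII] Cor. 3.12.
-/

namespace Literature.AnabelianGeometry.EtaleTheta

open CategoryTheory Literature.AlgebraicGeometry.Frobenioids FrobenioidThetaDivisors

universe w v v' u u'

namespace ThetaFrobenioid

variable {C : Type u} [Category.{v} C] {D : Type u'} [Category.{v'} D] (𝔉 : ThetaFrobenioid.{w} C D)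

/-- **(T1) with naturality**: under `hiso`, `induced` at `A_⊚` and a normalised transport `(a, b, w)` (`hT`, `hT′`) there is an
`e_N : Φ(A_N) ⥲ Φ(Ψ(A_N))` — the `A_N`-component of the SAME `Ψ^Φ` as `e` — with `ψ_a := (pullIso a)⁻¹ ∘ e_N` fixing `Div(s^⊓_N)` and
`Div(s^⊔_N)`, AND natural along every `φ : A_N → A_⊚`: `e_N (φ^* x) = (Ψφ)^* (e x)`.
[cite: MochizukiEtTh2009, Thm 5.7 p.330 (PDF p.104)] -/
theorem exists_psiPhiN_fixes_rootPair_natural_of_transport (hiso : ∀ ⦃X Y : C⦄ (c : X ≅ Y), 𝔉.pre.div c.hom = 1)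
    {Ψ : C ≌ C} {e : 𝔉.PhiAcirc ≃* 𝔉.pre.Mon (𝔉.base.obj (Ψ.functor.obj 𝔉.Acirc))}
    (h : (DivisorTransportStub.ofThm49 𝔉).IsInducedBy Ψ 𝔉.Acirc e)
    (a : Ψ.functor.obj 𝔉.AN ≅ 𝔉.AN) (b : Ψ.functor.obj 𝔉.BN ≅ 𝔉.BN) (w : Aut 𝔉.BN)
    (hT : a.inv ≫ Ψ.functor.map 𝔉.sCap ≫ b.hom = 𝔉.sCap)
    (hT' : a.inv ≫ Ψ.functor.map 𝔉.sCup ≫ b.hom = 𝔉.sCup ≫ w.hom) :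
    ∃ eN : 𝔉.pre.Mon (𝔉.base.obj 𝔉.AN) ≃* 𝔉.pre.Mon (𝔉.base.obj (Ψ.functor.obj 𝔉.AN)),
      (eN.trans (𝔉.pullIso a).symm) (𝔉.pre.div 𝔉.sCap) = 𝔉.pre.div 𝔉.sCap ∧
      (eN.trans (𝔉.pullIso a).symm) (𝔉.pre.div 𝔉.sCup) = 𝔉.pre.div 𝔉.sCup ∧
      ∀ (φ : 𝔉.AN ⟶ 𝔉.Acirc) (x : 𝔉.PhiAcirc),
        eN (𝔉.pre.pull (𝔉.base.map φ) x) = 𝔉.pre.pull (𝔉.base.map (Ψ.functor.map φ)) (e x) := by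
  obtain ⟨eN, hcap, hcup, hnat, -⟩ := exists_rootPairTransport_natural_of_isInducedBy 𝔉 h
  refine ⟨eN, ?_, ?_, hnat⟩
  · rw [MulEquiv.trans_apply, ← hcap, ← div_conj_eq_of_div_iso 𝔉 hiso a b, hT]
  · rw [MulEquiv.trans_apply, ← hcup, ← div_conj_eq_of_div_iso 𝔉 hiso a b, hT', div_comp_autHom_eq 𝔉 hiso]

/-- Base-compatibility of the CORRECTED anchor: if `σ ≫ φ^bs = (a⁻¹ ≫ Ψ(φ) ≫ ι₀)^bs` (torsor law) and `σ ≫ φ^bs = φ^bs ≫ g^bs`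
(Galois descent of `σ` to `g ∈ Aut_C(A_⊚)`), then `ι := ι₀ ≪≫ g⁻¹` satisfies `(a⁻¹ ≫ Ψ(φ) ≫ ι)^bs = φ^bs`.
[cite: MochizukiEtTh2009, Prop 5.3 p.325 (PDF p.99)] -/
theorem base_map_anchor_corrected {Ψ : C ≌ C} (a : Ψ.functor.obj 𝔉.AN ≅ 𝔉.AN)
    (ι₀ : Ψ.functor.obj 𝔉.Acirc ≅ 𝔉.Acirc) (φ : 𝔉.AN ⟶ 𝔉.Acirc) {σ : Aut (𝔉.base.obj 𝔉.AN)} {g : Aut 𝔉.Acirc}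
    (hσ : σ.hom ≫ 𝔉.base.map φ = 𝔉.base.map (a.inv ≫ Ψ.functor.map φ ≫ ι₀.hom))
    (hg : σ.hom ≫ 𝔉.base.map φ = 𝔉.base.map φ ≫ 𝔉.base.map g.hom) :
    𝔉.base.map (a.inv ≫ Ψ.functor.map φ ≫ (ι₀ ≪≫ g.symm).hom) = 𝔉.base.map φ := by
  have e1 : a.inv ≫ Ψ.functor.map φ ≫ (ι₀ ≪≫ g.symm).hom = (a.inv ≫ Ψ.functor.map φ ≫ ι₀.hom) ≫ g.inv := by
    simp only [Iso.trans_hom, Iso.symm_hom, Category.assoc]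
  rw [e1, Functor.map_comp, ← hσ, hg, Category.assoc, ← Functor.map_comp, g.hom_inv_id, CategoryTheory.Functor.map_id,
    Category.comp_id]

/-- **The KEY square**: for `e_N` natural along `φ` relative to `e` and an anchor `ι` at `A_⊚` base-compatible with `a` along
`φ`, `ψ_a ∘ (φ^bs)^* = (φ^bs)^* ∘ Ψ^Φ_{A_⊚, ι}` on `Φ(A_⊚)` (`ψ_a := (pullIso a)⁻¹ ∘ e_N`).
[cite: MochizukiFrdI2008, Thm. 4.9 p.88] -/
theorem psiPhiN_pull_eq_pull_psiPhi {Ψ : C ≌ C} {e : 𝔉.PhiAcirc ≃* 𝔉.pre.Mon (𝔉.base.obj (Ψ.functor.obj 𝔉.Acirc))}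
    {eN : 𝔉.pre.Mon (𝔉.base.obj 𝔉.AN) ≃* 𝔉.pre.Mon (𝔉.base.obj (Ψ.functor.obj 𝔉.AN))}
    (a : Ψ.functor.obj 𝔉.AN ≅ 𝔉.AN) (ι : Ψ.functor.obj 𝔉.Acirc ≅ 𝔉.Acirc) (φ : 𝔉.AN ⟶ 𝔉.Acirc)
    (hnat : ∀ x : 𝔉.PhiAcirc, eN (𝔉.pre.pull (𝔉.base.map φ) x) = 𝔉.pre.pull (𝔉.base.map (Ψ.functor.map φ)) (e x))
    (hbc : 𝔉.base.map (a.inv ≫ Ψ.functor.map φ ≫ ι.hom) = 𝔉.base.map φ) (x : 𝔉.PhiAcirc) :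
    (eN.trans (𝔉.pullIso a).symm) (𝔉.pre.pull (𝔉.base.map φ) x) =
      𝔉.pre.pull (𝔉.base.map φ) (psiPhi 𝔉 Ψ ι e x) := by
  have e2 : 𝔉.base.map (a.inv ≫ Ψ.functor.map φ) = 𝔉.base.map (φ ≫ ι.inv) := by
    rw [show a.inv ≫ Ψ.functor.map φ = (a.inv ≫ Ψ.functor.map φ ≫ ι.hom) ≫ ι.inv by
      simp only [Category.assoc, Iso.hom_inv_id, Category.comp_id], Functor.map_comp, hbc, ← Functor.map_comp]
  change 𝔉.pre.pull (𝔉.base.map a.inv) (eN (𝔉.pre.pull (𝔉.base.map φ) x)) =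
    𝔉.pre.pull (𝔉.base.map φ) (𝔉.pre.pull (𝔉.base.map ι.inv) (e x))
  rw [hnat, ← 𝔉.pre.pull_comp, ← 𝔉.pre.pull_comp, ← Functor.map_comp, ← Functor.map_comp, e2]

/-- **Descent of the fixed root divisors to `A_⊚` at the base-compatible anchor.**  Under «isomorphisms are isometries» (`hiso`),
`induced` at `A_⊚` ([FrdI] Thm. 4.9 at `ofThm49`), a NORMALISED transport `(a, b, w)` of the root pair (`hT`, `hT′`), some anchor
`ι₀ : Ψ(A_⊚) ⥲ A_⊚`, a morphism `φ : A_N → A_⊚` with the transitive torsor law of `A_N^bs → A_⊚^bs` (`hGal`) and Galois descent of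
base automorphisms of `A_N` to `Aut_C(A_⊚)` along `φ` (`hGalDesc`), injectivity of `(φ^bs)^*` on `Φ(A_⊚)^gp` (`hinjφ`), and the
descent of the root divisors `Div(s^⊓_N)^n = φ^* Z₀`, `Div(s^⊔_N)^n = φ^* W₀` (LINK (b), `hdesc`): THERE IS an anchor
`ι : Ψ(A_⊚) ⥲ A_⊚`, BASE-COMPATIBLE with `a` along `φ` — `(a⁻¹ ≫ Ψ(φ) ≫ ι)^bs = φ^bs` — whose divisor transport
`Ψ^Φ_{A_⊚, ι} = psiPhi 𝔉 Ψ ι e` FIXES `Z₀` AND `W₀` in `Φ(A_⊚)^gp` (hence `div(Θ̈) = Z₀·W₀⁻¹`).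
[cite: MochizukiEtTh2009, Thm 5.7 p.330 (PDF p.104); Prop 5.3 (vi) p.326 (PDF p.100)] -/
theorem exists_baseCompatible_anchor_psiPhi_fixes_of_transport
    (hiso : ∀ ⦃X Y : C⦄ (c : X ≅ Y), 𝔉.pre.div c.hom = 1)
    {Ψ : C ≌ C} {e : 𝔉.PhiAcirc ≃* 𝔉.pre.Mon (𝔉.base.obj (Ψ.functor.obj 𝔉.Acirc))}
    (h : (DivisorTransportStub.ofThm49 𝔉).IsInducedBy Ψ 𝔉.Acirc e)
    (a : Ψ.functor.obj 𝔉.AN ≅ 𝔉.AN) (b : Ψ.functor.obj 𝔉.BN ≅ 𝔉.BN) (w : Aut 𝔉.BN)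
    (hT : a.inv ≫ Ψ.functor.map 𝔉.sCap ≫ b.hom = 𝔉.sCap)
    (hT' : a.inv ≫ Ψ.functor.map 𝔉.sCup ≫ b.hom = 𝔉.sCup ≫ w.hom)
    (ι₀ : Ψ.functor.obj 𝔉.Acirc ≅ 𝔉.Acirc) (φ : 𝔉.AN ⟶ 𝔉.Acirc)
    (hGal : ∀ p q : 𝔉.base.obj 𝔉.AN ⟶ 𝔉.base.obj 𝔉.Acirc, ∃ σ : Aut (𝔉.base.obj 𝔉.AN), σ.hom ≫ p = q)
    (hGalDesc : ∀ σ : Aut (𝔉.base.obj 𝔉.AN), ∃ g : Aut 𝔉.Acirc,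
      σ.hom ≫ 𝔉.base.map φ = 𝔉.base.map φ ≫ 𝔉.base.map g.hom)
    (hinjφ : Function.Injective (AlgebraicGeometry.Frobenioids.gpMap (𝔉.pre.pull (𝔉.base.map φ))))
    {n : ℕ} {Z₀ W₀ : Algebra.GrothendieckGroup 𝔉.PhiAcirc}
    (hdesc : Algebra.GrothendieckGroup.of (𝔉.pre.div 𝔉.sCap) ^ n =
        AlgebraicGeometry.Frobenioids.gpMap (𝔉.pre.pull (𝔉.base.map φ)) Z₀ ∧
      Algebra.GrothendieckGroup.of (𝔉.pre.div 𝔉.sCup) ^ n =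
        AlgebraicGeometry.Frobenioids.gpMap (𝔉.pre.pull (𝔉.base.map φ)) W₀) :
    ∃ ι : Ψ.functor.obj 𝔉.Acirc ≅ 𝔉.Acirc,
      𝔉.base.map (a.inv ≫ Ψ.functor.map φ ≫ ι.hom) = 𝔉.base.map φ ∧
      ThetaFrobenioid.gpMap (psiPhi 𝔉 Ψ ι e : 𝔉.PhiAcirc →* 𝔉.PhiAcirc) Z₀ = Z₀ ∧
      ThetaFrobenioid.gpMap (psiPhi 𝔉 Ψ ι e : 𝔉.PhiAcirc →* 𝔉.PhiAcirc) W₀ = W₀ := by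
  obtain ⟨eN, hcap, hcup, hnat⟩ := 𝔉.exists_psiPhiN_fixes_rootPair_natural_of_transport hiso h a b w hT hT'
  obtain ⟨σ, hσ⟩ := hGal (𝔉.base.map φ) (𝔉.base.map (a.inv ≫ Ψ.functor.map φ ≫ ι₀.hom))
  obtain ⟨g, hg⟩ := hGalDesc σ
  have hbc := 𝔉.base_map_anchor_corrected a ι₀ φ hσ hg
  set ι := ι₀ ≪≫ g.symm with hι
  have key : ∀ x : 𝔉.PhiAcirc, (eN.trans (𝔉.pullIso a).symm) (𝔉.pre.pull (𝔉.base.map φ) x) =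
      𝔉.pre.pull (𝔉.base.map φ) (psiPhi 𝔉 Ψ ι e x) :=
    𝔉.psiPhiN_pull_eq_pull_psiPhi a ι φ (hnat φ) hbc
  have hcomp : (𝔉.pre.pull (𝔉.base.map φ)).comp (psiPhi 𝔉 Ψ ι e : 𝔉.PhiAcirc →* 𝔉.PhiAcirc) =
      ((eN.trans (𝔉.pullIso a).symm : 𝔉.pre.Mon (𝔉.base.obj 𝔉.AN) ≃* 𝔉.pre.Mon (𝔉.base.obj 𝔉.AN)) :
        𝔉.pre.Mon (𝔉.base.obj 𝔉.AN) →* 𝔉.pre.Mon (𝔉.base.obj 𝔉.AN)).comp (𝔉.pre.pull (𝔉.base.map φ)) :=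
    MonoidHom.ext fun x => (key x).symm
  -- fixedness descends along `(φ^bs)^*` for each part
  have fix : ∀ (d : 𝔉.pre.Mon (𝔉.base.obj 𝔉.AN)) (X₀ : Algebra.GrothendieckGroup 𝔉.PhiAcirc),
      (eN.trans (𝔉.pullIso a).symm) d = d →
      Algebra.GrothendieckGroup.of d ^ n = AlgebraicGeometry.Frobenioids.gpMap (𝔉.pre.pull (𝔉.base.map φ)) X₀ →
      ThetaFrobenioid.gpMap (psiPhi 𝔉 Ψ ι e : 𝔉.PhiAcirc →* 𝔉.PhiAcirc) X₀ = X₀ := by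
    intro d X₀ hd hX
    apply hinjφ
    rw [gpMap_eq_gpMap, ← MonoidHom.comp_apply, ← AlgebraicGeometry.Frobenioids.gpMap_comp, hcomp,
      AlgebraicGeometry.Frobenioids.gpMap_comp, MonoidHom.comp_apply, ← hX, map_pow,
      AlgebraicGeometry.Frobenioids.gpMap_of]
    change Algebra.GrothendieckGroup.of ((eN.trans (𝔉.pullIso a).symm) d) ^ n = _
    rw [hd]
  exact ⟨ι, hbc, fix _ Z₀ hcap hdesc.1, fix _ W₀ hcup hdesc.2⟩

end ThetaFrobenioid

end Literature.AnabelianGeometry.EtaleTheta
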